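import Summits.QuantumFields.BalabanUV.Beta.EriceFlowEnclosureB12AsPrintedPointwiseFadingEventualAFEnd
import Summits.QuantumFields.BalabanUV.Beta.EriceFlowEnclosureB12AsPrintedHistoryContagionShiftEnd

/-!
# Beta / EriceFlowEnclosureB12AsPrintedPointwiseFadingEventualAFBigBox — WHAT (0.31) FORCES, part 10f: THE POINTWISE FLOOR `.lower` FOR bflow-p1's BIG-BOX FAMILIES.  bflow-p1 #64a∕#64b
# (`…HistoryContagionShift ∕ ShiftEnd`) book, floor-FREE, node U2's `InjectedRate`, the continuum running coupling `gstar`, the limit flow, the geometric tail and the two-sided running with an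
# end-anchored defect for EVERY family of rows lying in a BIG box ]0, γ_u] and pinned at a small renormalized coupling g_IR (`continuumCoupling_bigBox_of_typedTheorem2`), recording «what replaces
# `ContinuumRunning.lower`, which is NOT obtained».  Their contagion profile also CONFINES such families: `quarterProf_le_invSq` reads `1∕(4g_IR²) + (β*∕4)m ≤ 1∕(g (n+m) n)²` at every physical scale,
# so EVERY entry of EVERY row is ≤ 2g_IR (§1 `rows_le_two_pin_of_reference`) — a big-box family pinned near zero lives in a small box.  Part 10c's package (`continuumRunning_smallBox_of_typedTheorem2`,
# the eventual AF letter derived in part 10b from the typed Theorem 2 + the same moduli + NE4) therefore applies: **`continuumRunning_bigBox_of_typedTheorem2`** — ∃ b > 0 ∀ m ∃ g₂ > 0: EVERY family of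
# rows in ]0, γ_u] pinned at g_IR ≤ g₂ carries node U2's FULL `ContinuumRunning S.β g g_IR (2g_IR) b`, INCLUDING `.lower` (`bstar g m′ ≥ b > 0` at every physical scale) and `.af` — #64b's list
# completed by the pointwise floor, with the same binders (β-flow team, prover 2 = lower ∕ positivity side, unit `b2b-balaban-beta-bflow-p2`, gen 46; ROW AP-I·Uc×U2 (bflow-p1) × part 10c; junction only)

HONEST FRAMING (page 1 of everything the β sub-cell writes): discharging `BetaPertH` makes Bałaban's UV stability UNCONDITIONAL — a
real constructive-QFT result; it is NOT the continuum limit and NOT the Clay problem.  HONEST DEPENDENCY (cell reorg 2026-08-19,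
verbatim): «continuum YM on T⁴ ⇐ BetaPertH ∧ nine spine estimates (0/9 proved); BetaPertH ⇐ (D1) ∧ (D4) ∧ CAP+tail; G-an2-4 gates
asym, D1 and NE2/3/4.»  THIS MODULE DISCHARGES NOTHING: bookkeeping BY NAME over bflow-p1's #64a∕#64b (`quarterProf_le_invSq`, `referenceFamily_of_typedTheorem2`), #63b (`threshold_exists`),
part 10c, and the NAMED FIELDS of `B12BetaAsPrinted` ([Balaban1987RG1] as typed; `Theorem2Statement` STATED WITHOUT PROOF in print, p. 259 — a HYPOTHESIS) under LETTERS displayed as hypotheses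
(prover 1's binder `hrg`, node U2's `HistLipschitz ∕ FadingMemory ∕ ScaleShiftRate` — NOT printed).  «Continuum running coupling» = the K → ∞ limit of the effective couplings of (0.20) at fixed
physical scale, NOT the continuum limit of the measures.  Nothing of Bałaban's objects is asserted.

WHAT THIS FILE PROVES (0 sorry, 0 def): §1 **`rows_le_two_pin_of_reference`** (every entry of a pinned family below the contagion threshold is ≤ 2g_IR), `exists_confinement_threshold`;
§2 **`continuumRunning_bigBox_of_typedTheorem2`** (node U2's full package incl. `.lower`∕`.af` for EVERY pinned family of rows in the BIG box with g_IR ≤ g₂).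
NOT CLAIMED: any letter for Bałaban's β; the continuum limit of the measures; which reading print intends; Theorem 2; `BetaPertH`; Clay.
-/

namespace Summit.QuantumFields.BalabanUV.Beta.EriceFlowEnclosureB12AsPrintedPointwiseFadingEventualAFBigBox

open Literature.MathematicalPhysics.QuantumFieldTheory.Balaban1983to89
open Literature.MathematicalPhysics.QuantumFieldTheory.Balaban1983to89.B12BetaAsPrinted
open Literature.MathematicalPhysics.QuantumFieldTheory.Balaban1983to89.FlowStep (HBeta prefixOf Box mem_box RGEqH)
open Literature.MathematicalPhysics.QuantumFieldTheory.Balaban1983to89.T4CouplingMatching (HistLipschitz FadingMemory ScaleShiftRate EventualLowerH)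
open Literature.MathematicalPhysics.QuantumFieldTheory.Balaban1983to89.T4ContinuumCoupling (ContinuumRunning invSq)
open Summit.QuantumFields.BalabanUV.Beta.EriceFlowEnclosureB12AsPrintedHistoryContagionProfile (threshold_exists)
open Summit.QuantumFields.BalabanUV.Beta.EriceFlowEnclosureB12AsPrintedHistoryContagionShift (quarterProf_le_invSq)
open Summit.QuantumFields.BalabanUV.Beta.EriceFlowEnclosureB12AsPrintedHistoryContagionShiftEnd (referenceFamily_of_typedTheorem2)
open Summit.QuantumFields.BalabanUV.Beta.EriceFlowEnclosureB12AsPrintedPointwiseFadingEventualAFEnd (continuumRunning_smallBox_of_typedTheorem2)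

noncomputable section

variable {S : Setting}

/-! ## §1 Confinement: a big-box family pinned near zero lives in the box ]0, 2g_IR] -/

/-- **CONFINEMENT BY THE CONTAGION PROFILE.**  Under node U2's moduli on ]0, γ] (0 ≤ θ < 1) and a pinned (0.31)-reference family t (endpoint g*, slope β*), every family g of runs of (0.20) in
]0, γ] pinned at g_IR below #63b's two smallness conditions has ALL its entries ≤ 2g_IR: bflow-p1's `quarterProf_le_invSq` at physical scale m = K − i reads `1∕(4g_IR²) ≤ 1∕(g K i)²`.
[cite: Balaban1987RG1, Thm 2 (0.31) p.259 with (0.20) p.256] -/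
theorem rows_le_two_pin_of_reference {γ θ C bs gs gIR : ℝ} {Λ : ℕ → ℕ → ℝ} {g t : ℕ → ℕ → ℝ}
    (hθ0 : 0 ≤ θ) (hθ1 : θ < 1) (hC : 0 ≤ C) (hbs : 0 < bs)
    (hL : HistLipschitz Λ γ S.β) (hΛ : FadingMemory C θ Λ)
    (hrun : ∀ K, RGEqH K S.β (g K)) (hbox : ∀ K i, i ≤ K → 0 < g K i ∧ g K i ≤ γ) (hpin : ∀ K, g K K = gIR)
    (hrunt : ∀ K, RGEqH K S.β (t K)) (hboxt : ∀ K i, i ≤ K → 0 < t K i ∧ t K i ≤ γ) (hpint : ∀ K, t K K = gs)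
    (h031 : ∀ (K i : ℕ), i ≤ K → 1 / gs ^ 2 + bs * ((K : ℝ) - i) ≤ 1 / (t K i) ^ 2)
    (hs1 : 4 * C * gIR ≤ bs * (1 - θ))
    (hs2 : gIR ^ 2 * (C * γ / (1 - θ) ^ 2 + C / (1 - θ) * gs + (2 * C / ((1 - θ) * bs)) ^ 2 + 1 / (4 * gs ^ 2)) ≤ 3 / 4)
    (K i : ℕ) (hi : i ≤ K) : g K i ≤ 2 * gIR := by
  have hgIR : 0 < gIR := by rw [← hpin 0]; exact (hbox 0 0 le_rfl).1
  obtain ⟨m, rfl⟩ : ∃ m, K = i + m := ⟨K - i, by omega⟩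
  have h := quarterProf_le_invSq hθ0 hθ1 hC hbs hL hΛ hrun hbox hpin hrunt hboxt hpint h031 hs1 hs2 m i
  rw [T4ContinuumCoupling.invSq_def] at h
  have hgi := (hbox (i + m) i (Nat.le_add_right i m)).1
  have hm0 : (0 : ℝ) ≤ bs / 4 * (m : ℝ) := by positivity
  have hq : 1 / (4 * gIR ^ 2) ≤ 1 / (g (i + m) i) ^ 2 := by linarith
  have hsq : (g (i + m) i) ^ 2 ≤ 4 * gIR ^ 2 := by
    rw [div_le_div_iff₀ (by positivity) (by positivity)] at hq
    nlinarith
  have h2 : (g (i + m) i) ^ 2 ≤ (2 * gIR) ^ 2 := by nlinarith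
  exact (pow_le_pow_iff_left₀ hgi.le (by positivity) two_ne_zero).mp h2

/-- **THE CONFINEMENT THRESHOLD FROM THE TYPED THEOREM 2.**  `Theorem2Statement S hL` + `hrg` on ]0, γ_u] + node U2's moduli (0 ≤ θ < 1) ⟹ for every m there is e₀ > 0 such that EVERY family of rows
(any torus exponent per depth) in ]0, γ_u] pinned at g_IR ≤ e₀ has all entries ≤ 2g_IR (the reference family is Theorem 2's at exponent m, `referenceFamily_of_typedTheorem2`; `threshold_exists`).
[cite: Balaban1987RG1, Thm 2 (0.31) p.259 with (0.20) p.256] -/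
theorem exists_confinement_threshold {hL : Odd S.L ∧ 1 < S.L} (hT : Theorem2Statement S hL)
    {γu θ C : ℝ} {Λ : ℕ → ℕ → ℝ} (hγu : 0 < γu)
    (hrg : ∀ P : B12.RunParams, Step.InInterval γu P.K (S.cpl P) → RGEqH P.K S.β (S.cpl P))
    (hLip : HistLipschitz Λ γu S.β) (hΛ : FadingMemory C θ Λ) (hθ0 : 0 ≤ θ) (hθ1 : θ < 1) (hC : 0 ≤ C) (m : ℕ) :
    ∃ e₀ : ℝ, 0 < e₀ ∧ ∀ (g : ℕ → ℕ → ℝ) (gIR : ℝ),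
      (∀ K, ∃ (m' : ℕ) (g₀ : ℝ), g K = S.cpl ⟨K, m', g₀⟩) → (∀ K, Step.InInterval γu K (g K)) → (∀ K, g K K = gIR) → gIR ≤ e₀ →
        ∀ K i, i ≤ K → g K i ≤ 2 * gIR := by
  obtain ⟨g₀, gs, bs, bs', _, hbs, _, hrunt, hboxt, hpint, h031, -⟩ := referenceFamily_of_typedTheorem2 hT hγu hrg m
  obtain ⟨e₀, he₀, hthr⟩ := threshold_exists (γ := γu) gs hθ1 hC hbs
  refine ⟨e₀, he₀, fun g gIR hrow hI hpin hle K i hi => ?_⟩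
  have hbox : ∀ K i, i ≤ K → 0 < g K i ∧ g K i ≤ γu := fun K => hI K
  have hrun : ∀ K, RGEqH K S.β (g K) := fun K => by
    obtain ⟨m', g₀', hK⟩ := hrow K
    rw [hK]
    exact hrg ⟨K, m', g₀'⟩ (by rw [← hK]; exact hI K)
  have hgIR : 0 < gIR := by rw [← hpin 0]; exact (hbox 0 0 le_rfl).1
  obtain ⟨hs1, hs2, -⟩ := hthr gIR hgIR hle
  exact rows_le_two_pin_of_reference hθ0 hθ1 hC hbs hLip hΛ hrun hbox hpin hrunt hboxt hpint h031 hs1 hs2 K i hi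

/-! ## §2 bflow-p1's big-box package completed by the pointwise floor -/

/-- **NODE U2's FULL PACKAGE — INCLUDING `.lower` — FOR EVERY BIG-BOX FAMILY PINNED NEAR ZERO.**  `Theorem2Statement S hL` AS TYPED + `hrg` on ]0, γ_u] + `HistLipschitz Λ γ_u S.β` with
`FadingMemory C_m θ Λ` + `ScaleShiftRate c θ γ_u S.β` (0 < θ < 1; 0 ≤ C_m, c) — exactly bflow-p1 #64b's binders — ⟹ there is a floor b > 0 and, for every torus exponent m, thresholds 0 < g₂ and a box
δ′ ≤ γ_u such that EVERY family `K ↦ g K` of rows (any torus exponent per depth, any bare coupling) lying in ]0, γ_u] and pinned at `g K K = g_IR ≤ g₂` carries `ContinuumRunning S.β g g_IR δ′ b`: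
convergence at every physical scale, the limit flow, the geometric tail, `gstar g 0 = g_IR`, **`b ≤ bstar g m′` for every m′** and `gstar g m′ ≤ 1∕sprof g_IR b m′`.  (§1 confines the family to
]0, 2g_IR] ⊆ ]0, δ′]; part 10c supplies the package there.)  #64b's «`ContinuumRunning.lower` NOT obtained» — obtained, for the same families below a smaller pin threshold.
[cite: Balaban1987RG1, Thm 2 (0.31) p.259 with (0.20) p.256, §1 p.264 and §5 p.298] -/
theorem continuumRunning_bigBox_of_typedTheorem2 {hL : Odd S.L ∧ 1 < S.L} (hT : Theorem2Statement S hL)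
    {γu Cm c θ : ℝ} {Λ : ℕ → ℕ → ℝ} (hγu : 0 < γu) (hθ0 : 0 < θ) (hθ1 : θ < 1) (hCm : 0 ≤ Cm) (hc : 0 ≤ c)
    (hrg : ∀ P : B12.RunParams, Step.InInterval γu P.K (S.cpl P) → RGEqH P.K S.β (S.cpl P))
    (hLip : HistLipschitz Λ γu S.β) (hΛ : FadingMemory Cm θ Λ) (hS : ScaleShiftRate c θ γu S.β) :
    ∃ b : ℝ, 0 < b ∧ ∀ m : ℕ, ∃ g₂ δ' : ℝ, 0 < g₂ ∧ 0 < δ' ∧ δ' ≤ γu ∧ ∀ (g : ℕ → ℕ → ℝ) (gIR : ℝ),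
      (∀ K, ∃ (m' : ℕ) (g₀ : ℝ), g K = S.cpl ⟨K, m', g₀⟩) → (∀ K, Step.InInterval γu K (g K)) → (∀ K, g K K = gIR) → gIR ≤ g₂ →
        ContinuumRunning S.β g gIR δ' b := by
  obtain ⟨b, hb, hall⟩ := continuumRunning_smallBox_of_typedTheorem2 hT hγu hθ0 hθ1 hCm hc hrg hLip hΛ hS
  refine ⟨b, hb, fun m => ?_⟩
  obtain ⟨e₀, he₀, hconf⟩ := exists_confinement_threshold hT hγu hrg hLip hΛ hθ0.le hθ1 hCm m
  obtain ⟨δ', hδ'pos, hδ'u, -, hpkg⟩ := hall γu hγu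
  refine ⟨min e₀ (δ' / 2), δ', lt_min he₀ (by positivity), hδ'pos, hδ'u, fun g gIR hrow hI hpin hle => ?_⟩
  have hrun : ∀ K, RGEqH K S.β (g K) := fun K => by
    obtain ⟨m', g₀', hK⟩ := hrow K
    rw [hK]
    exact hrg ⟨K, m', g₀'⟩ (by rw [← hK]; exact hI K)
  have hsmall := hconf g gIR hrow hI hpin (hle.trans (min_le_left _ _))
  have hbox : ∀ K i, i ≤ K → 0 < g K i ∧ g K i ≤ δ' := fun K i hi =>
    ⟨(hI K i hi).1, (hsmall K i hi).trans (by linarith [hle.trans (min_le_right e₀ (δ' / 2))])⟩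
  exact hpkg g gIR hrun hbox hpin

end

end Summit.QuantumFields.BalabanUV.Beta.EriceFlowEnclosureB12AsPrintedPointwiseFadingEventualAFBigBox
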